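import Summits.AtomisticToContinuum.HydrodynamicLimit.Theorems.AntiMazurCoboundariesCorrectorPressureDecayKiferWallGibbsSanitySpec
import Summits.AtomisticToContinuum.HydrodynamicLimit.Theorems.AntiMazurCoboundariesCorrectorPressureDecayKiferWall
import Summits.AtomisticToContinuum.HydrodynamicLimit.Theorems.AntiMazurCoboundariesCorrectorPressureDecayTangentBiasWindow
import Mathlib.Probability.Independence.Basic

/-!
# The wall of line `FirstLemma` at a Gibbs state: the fast one-body bias vanishes (sanity instance)

Crux stmt-AtomisticToContinuum-14135 `AntiMazurCoboundaries.CorrectorPressureDecay` ("X"), line `FirstLemma` (idea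
`kifer-compactification`), namespace `…Theorems.KiferCompactification`; registered stub `stub_gibbsFastBiasVanishes`
(a CONSISTENCY INSTANCE of the wall `EntropicBoltzmannPropertyTangent` of `…KiferWall.lean`, not the wall). For a
hard-sphere DLR Gibbs state `G` (`IsHardSphereGibbs 1 z θ⁻¹ u₀ G`) and a bounded continuous `g` with `∫ g d𝒩(0, I) = 0`,
the unit-cube window functional `ω ↦ Σ_{p ∈ ω, p.1 ∈ [0,1)³} g((√θ)⁻¹(p.2 − u₀))` is `G`-integrable with mean ZERO, so the
wall's inequality holds at `μ = G` against every reference (`wall_inequality_of_isHardSphereGibbs`). Route (Alexander 1976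
§2.1): by the DLR equation for functions (`…KiferWallGibbsSanitySpec.lean`) integrate against the specification
`γ_Λ(·|Y)`, `Λ = [0,1)³`: the particles above `Λ` are the thrown ones, a.s. with distinct positions in `Λ`, the hard core is
a function of the positions, and the velocities are i.i.d. `𝒩(u₀, θI)` (`maxwellPhaseMeasure θ⁻¹ u₀ Λ = Leb|_Λ ⊗ gaussMeasure
u₀ θ`), so each velocity integral is `∫ g d𝒩(0, I) = 0` (Fubini via `arrowProdEquivProdArrow`). Integrability:
`E_G[#(particles above Λ)] ≤ ∑ₖ zᵏ k / k! < ∞` and `windowSum_approx`.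
-/

noncomputable section

open MeasureTheory ProbabilityTheory Set Filter Topology Function
open scoped ENNReal

namespace Summit.AtomisticToContinuum.HydrodynamicLimit.Theorems.KiferCompactification

open Literature.Analysis.FluidPDE (IsHardSphereGibbs HardCoreIn superposeIn gibbsWeight gibbsSpec maxwellPhaseMeasure particlesIn)
open Literature.Analysis.FluidPDE (mem_particlesIn_iff windowSumReal localMaxwellian)
open Literature.Analysis.FunctionSpaces (PointConfig maxwellianBeta)
open Literature.Analysis.FunctionSpaces.Torus (unitCube measurableSet_unitCube)
open Literature.MathematicalPhysics.KineticTheory (V3 gaussMeasure integral_gaussMeasure withDensity_localMaxwellian_eq_gaussMeasure)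
open Literature.MathematicalPhysics.KineticTheory.PointProcess (specificRelEntropy)

/-! ## The one-particle a-priori law at inverse temperature `θ⁻¹` and drift `u₀` -/

/-- The a-priori law in the window is `Leb|_Λ ⊗ 𝒩(u₀, θ I)`: `M_{θ⁻¹}(v − u₀) dv = gaussMeasure u₀ θ`. -/
theorem maxwellPhaseMeasure_inv_eq_prod_gaussMeasure {θ : ℝ} (hθ : 0 < θ) (u₀ : V3) (Λ : Set V3) :
    maxwellPhaseMeasure θ⁻¹ u₀ Λ = ((volume : Measure V3).restrict Λ).prod (gaussMeasure u₀ θ) := by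
  have hdens : (fun v : V3 => ENNReal.ofReal (maxwellianBeta θ⁻¹ (v - u₀))) =
      fun v => ENNReal.ofReal (localMaxwellian 1 θ u₀ v) := by
    funext v
    simp only [maxwellianBeta, localMaxwellian, inv_inv, sub_zero]
  rw [Literature.Analysis.FluidPDE.maxwellPhaseMeasure, hdens, withDensity_localMaxwellian_eq_gaussMeasure hθ u₀]

/-- The rescaled one-body observable has the standard Gaussian mean under `𝒩(u₀, θ I)`:
`∫ g((√θ)⁻¹(v − u₀)) 𝒩(u₀, θI)(dv) = ∫ g d𝒩(0, I)`. -/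
theorem integral_comp_rescale_gaussMeasure {θ : ℝ} (hθ : 0 < θ) (u₀ : V3) (g : V3 → ℝ) :
    ∫ v, g ((Real.sqrt θ)⁻¹ • (v - u₀)) ∂(gaussMeasure u₀ θ) = ∫ w, g w ∂(stdGaussian V3) := by
  rw [integral_gaussMeasure u₀ hθ]
  refine integral_congr_ae (ae_of_all _ fun w => ?_)
  simp only
  rw [add_sub_cancel_left, inv_smul_smul₀ (Real.sqrt_pos.2 hθ).ne']

/-- Two distinct coordinates of a product probability measure are distributed as the product of two factors. -/
private theorem pi_map_pair {ι X : Type*} [Fintype ι] [MeasurableSpace X] (γ : Measure X) [IsProbabilityMeasure γ]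
    {i j : ι} (hij : i ≠ j) : (Measure.pi fun _ : ι => γ).map (fun v => (v i, v j)) = γ.prod γ := by
  have hind : IndepFun (fun v : ι → X => v i) (fun v => v j) (Measure.pi fun _ : ι => γ) :=
    (iIndepFun_pi (μ := fun _ : ι => γ) (X := fun _ => id) fun _ => aemeasurable_id).indepFun hij
  rw [(indepFun_iff_map_prod_eq_prod_map_map (measurable_pi_apply i).aemeasurable
    (measurable_pi_apply j).aemeasurable).1 hind, (measurePreserving_eval (fun _ : ι => γ) i).map_eq,
    (measurePreserving_eval (fun _ : ι => γ) j).map_eq]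

/-- Under `(Leb|_Λ ⊗ M)^{⊗k}` (`M` a probability law) a.s. all thrown positions lie in `Λ` and are pairwise distinct. -/
theorem ae_pi_prod_restrict_good {Λ : Set V3} (hΛ : MeasurableSet Λ) (hΛ1 : volume Λ = 1) (M : Measure V3)
    [IsProbabilityMeasure M] (k : ℕ) :
    ∀ᵐ x ∂(Measure.pi fun _ : Fin k => ((volume : Measure V3).restrict Λ).prod M),
      (∀ i, (x i).1 ∈ Λ) ∧ ∀ i j, (x i).1 = (x j).1 → i = j := by
  haveI : IsProbabilityMeasure ((volume : Measure V3).restrict Λ) :=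
    ⟨by rw [Measure.restrict_apply_univ, hΛ1]⟩
  set ρ : Measure (V3 × V3) := ((volume : Measure V3).restrict Λ).prod M with hρ
  have hout : ρ (Prod.fst ⁻¹' Λᶜ) = 0 := by
    rw [← Set.prod_univ, hρ, Measure.prod_prod, Measure.restrict_apply hΛ.compl, Set.compl_inter_self,
      measure_empty, zero_mul]
  have hfst : ∀ q : V3, ρ (Prod.fst ⁻¹' {q}) = 0 := fun q => by
    have h0 : (volume.restrict Λ) ({q} : Set V3) = 0 :=
      nonpos_iff_eq_zero.1 ((Measure.le_iff'.1 Measure.restrict_le_self {q}).trans_eq (measure_singleton q))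
    rw [← Set.prod_univ, hρ, Measure.prod_prod, h0, zero_mul]
  refine Filter.eventually_and.2 ⟨ae_all_iff.2 fun i => ?_, ae_all_iff.2 fun i => ae_all_iff.2 fun j => ?_⟩
  · rw [ae_iff]
    exact Measure.pi_eval_preimage_null (fun _ : Fin k => ρ) (i := i) hout
  · by_cases hij : i = j
    · exact ae_of_all _ fun _ _ => hij
    · have hD : MeasurableSet {p : (V3 × V3) × (V3 × V3) | p.1.1 = p.2.1} :=
        measurableSet_eq_fun measurable_fst.fst measurable_snd.fst
      have hnull : (Measure.pi fun _ : Fin k => ρ) ((fun x => (x i, x j)) ⁻¹' {p : (V3 × V3) × (V3 × V3) | p.1.1 = p.2.1}) = 0 := by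
        rw [← Measure.map_apply ((measurable_pi_apply i).prodMk (measurable_pi_apply j)) hD, pi_map_pair ρ hij,
          Measure.prod_apply hD]
        refine (lintegral_congr fun a => ?_).trans lintegral_zero
        have : Prod.mk a ⁻¹' {p : (V3 × V3) × (V3 × V3) | p.1.1 = p.2.1} = Prod.fst ⁻¹' {a.1} := by
          ext b
          simp only [mem_preimage, mem_setOf_eq, mem_singleton_iff, eq_comm]
        rw [this, hfst]
      rw [ae_iff]
      exact measure_mono_null (fun x hx => by
        simp only [mem_setOf_eq, Classical.not_imp] at hx
        exact hx.1) hnull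

/-! ## Campbell sums of positive parts (measurable representatives of the window functional) -/

/-- `Σ_{p ∈ X} (u p)⁺ ∈ [0, ∞]`, a measurable function of the configuration. -/
def posSum (u : V3 × V3 → ℝ) (X : PointConfig (V3 × V3)) : ℝ≥0∞ :=
  ∑' p : (X : Set (V3 × V3)), ENNReal.ofReal (max (u p) 0)

/-- `posSum u` is measurable for measurable `u` (Campbell measurability). -/
theorem measurable_posSum {u : V3 × V3 → ℝ} (hu : Measurable u) : Measurable (posSum u) :=
  PointConfig.measurable_tsum_carrier
    (f := fun q : PointConfig (V3 × V3) × (V3 × V3) => ENNReal.ofReal (max (u q.2) 0))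
    ((hu.comp measurable_snd).max measurable_const).ennreal_ofReal measurable_id

/-- For `|u| ≤ κ` vanishing off the cylinder above `Λ`: `posSum u X ≤ κ · #(particles of X above Λ)`. -/
theorem posSum_le_count {u : V3 × V3 → ℝ} {κ : ℝ} (hκ : 0 ≤ κ) (huκ : ∀ p, |u p| ≤ κ) {Λ : Set V3}
    (hu0 : ∀ p, p.1 ∉ Λ → u p = 0) (X : PointConfig (V3 × V3)) :
    posSum u X ≤ ENNReal.ofReal κ * ((X.count (Λ ×ˢ (univ : Set V3)) : ℕ∞) : ℝ≥0∞) := by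
  have hcount : ∑' p : (X : Set (V3 × V3)), (Λ ×ˢ (univ : Set V3)).indicator (1 : V3 × V3 → ℝ≥0∞) p =
      ((X.count (Λ ×ˢ (univ : Set V3)) : ℕ∞) : ℝ≥0∞) := by
    rw [tsum_subtype (X : Set (V3 × V3)) ((Λ ×ˢ (univ : Set V3)).indicator (1 : V3 × V3 → ℝ≥0∞)),
      Set.indicator_indicator, ← tsum_subtype]
    simp only [Pi.one_apply, ENNReal.tsum_set_one]
    rfl
  rw [← hcount, posSum, ← ENNReal.tsum_mul_left]
  refine ENNReal.tsum_le_tsum fun p => ?_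
  by_cases hp : (p : V3 × V3).1 ∈ Λ
  · rw [Set.indicator_of_mem (show (p : V3 × V3) ∈ Λ ×ˢ (univ : Set V3) from ⟨hp, mem_univ _⟩), Pi.one_apply, mul_one]
    exact ENNReal.ofReal_le_ofReal (max_le ((le_abs_self _).trans (huκ _)) hκ)
  · rw [hu0 _ hp, max_self, ENNReal.ofReal_zero]
    exact zero_le

/-- On a configuration with finitely many particles above the cube, the window functional of `Gt` is the difference
of the positive-part Campbell sums of the cut-off observable `u = 1_{[0,1)³}(p.1) Gt(p)` and of `−u`. -/
theorem windowSumReal_eq_posSum_sub {X : PointConfig (V3 × V3)} (hX : (particlesIn X (unitCube (Fin 3))).Finite)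
    (Gt : V3 × V3 → ℝ) :
    windowSumReal X (unitCube (Fin 3)) Gt =
      (posSum ((Prod.fst ⁻¹' unitCube (Fin 3)).indicator Gt) X).toReal -
        (posSum (fun p => -(Prod.fst ⁻¹' unitCube (Fin 3)).indicator Gt p) X).toReal := by
  have hu : ∀ p, (Prod.fst ⁻¹' unitCube (Fin 3)).indicator Gt p ≠ 0 → p.1 ∈ unitCube (Fin 3) := fun p hp =>
    show p ∈ Prod.fst ⁻¹' unitCube (Fin 3) from Set.mem_of_indicator_ne_zero hp
  rw [posSum, posSum, tsum_posPart_sub_eq_sum hX hu, windowSumReal_eq_sum hX]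
  refine Finset.sum_congr rfl fun p hp => ?_
  rw [hX.mem_toFinset, mem_particlesIn_iff] at hp
  exact (Set.indicator_of_mem (show p ∈ Prod.fst ⁻¹' unitCube (Fin 3) from hp.2) Gt).symm

/-- On a superposition whose thrown points are distinct with positions in `Λ`, the positive-part Campbell sum of an
observable vanishing off the cylinder above `Λ` is the finite sum over the thrown points. -/
theorem posSum_superposeIn {u : V3 × V3 → ℝ} {Λ : Set V3} (hu0 : ∀ p, p.1 ∉ Λ → u p = 0) {k : ℕ}
    {x : Fin k → V3 × V3} (hx : ∀ i, (x i).1 ∈ Λ) (hinj : Function.Injective x) (Y : PointConfig (V3 × V3)) :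
    posSum u (superposeIn Λ x Y) = ENNReal.ofReal (∑ i, max (u (x i)) 0) := by
  classical
  rw [posSum, ENNReal.ofReal_sum_of_nonneg fun i _ => le_max_right _ _,
    tsum_subtype ((superposeIn Λ x Y : PointConfig (V3 × V3)) : Set (V3 × V3)) fun p => ENNReal.ofReal (max (u p) 0)]
  have hsupp : ∀ p : V3 × V3, p ∉ (Finset.univ.image x : Finset (V3 × V3)) →
      ((superposeIn Λ x Y : PointConfig (V3 × V3)) : Set (V3 × V3)).indicator
        (fun p => ENNReal.ofReal (max (u p) 0)) p = 0 := by
    intro p hp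
    by_cases hpX : p ∈ ((superposeIn Λ x Y : PointConfig (V3 × V3)) : Set (V3 × V3))
    · rw [Set.indicator_of_mem hpX]
      rcases (mem_superposeIn_iff Λ x Y p).1 hpX with ⟨⟨i, rfl⟩, -⟩ | ⟨-, hpc⟩
      · exact absurd (Finset.mem_image_of_mem x (Finset.mem_univ i)) hp
      · rw [hu0 p hpc, max_self, ENNReal.ofReal_zero]
    · exact Set.indicator_of_notMem hpX _
  rw [tsum_eq_sum (s := Finset.univ.image x) fun p hp => hsupp p hp, Finset.sum_image fun i _ j _ h => hinj h]
  refine Finset.sum_congr rfl fun i _ => ?_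
  exact Set.indicator_of_mem (show x i ∈ ((superposeIn Λ x Y : PointConfig (V3 × V3)) : Set (V3 × V3)) from
    (mem_superposeIn_iff Λ x Y (x i)).2 (Or.inl ⟨⟨i, rfl⟩, hx i⟩)) _

/-! ## The velocity average of the one-body observable under the specification vanishes -/

/-- A bounded continuous real function is integrable against a finite measure. -/
private theorem integrable_of_continuous_abs_le {α : Type*} [MeasurableSpace α] [TopologicalSpace α]
    [OpensMeasurableSpace α] {μ : Measure α} [IsFiniteMeasure μ] {f : α → ℝ} (hf : Continuous f) {C : ℝ}
    (hfC : ∀ x, |f x| ≤ C) : Integrable f μ :=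
  Integrable.of_bound hf.measurable.aestronglyMeasurable C (ae_of_all _ fun x => by rw [Real.norm_eq_abs]; exact hfC x)

/-- **Fubini step.** Under `(Leb|_Λ ⊗ 𝒩(u₀, θI))^{⊗k}` restricted to the hard-core event of the superposition with a
boundary condition `Y` (`vol Λ = 1`), each velocity observable `g((√θ)⁻¹((x i).2 − u₀))` with `∫ g d𝒩(0,I) = 0`
integrates to zero: a.s. the hard-core event is a function of the positions only (`hardCoreIn_superposeIn_iff`), and the
velocities are independent of the positions with law `𝒩(u₀, θI)`. -/
theorem setIntegral_hardCore_velocity_eq_zero {θ : ℝ} (hθ : 0 < θ) (u₀ : V3) {g : V3 → ℝ} (hg : Continuous g)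
    (hg0 : ∫ v, g v ∂(stdGaussian V3) = 0) {Λ : Set V3} (hΛ : MeasurableSet Λ) (hΛ1 : volume Λ = 1)
    (Y : PointConfig (V3 × V3)) (k : ℕ) (i : Fin k) :
    ∫ x in {x : Fin k → V3 × V3 | HardCoreIn 1 Λ (superposeIn Λ x Y)}, g ((Real.sqrt θ)⁻¹ • ((x i).2 - u₀))
      ∂(Measure.pi fun _ : Fin k => ((volume : Measure V3).restrict Λ).prod (gaussMeasure u₀ θ)) = 0 := by
  haveI : IsProbabilityMeasure ((volume : Measure V3).restrict Λ) := ⟨by rw [Measure.restrict_apply_univ, hΛ1]⟩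
  set H : Set (Fin k → V3 × V3) := {x | HardCoreIn 1 Λ (superposeIn Λ x Y)} with hH
  have hHm : MeasurableSet H := measurableSet_hardCoreIn_superposeIn_left 1 hΛ k Y
  set Hq : Set (Fin k → V3) :=
    {q | (∀ i j, i ≠ j → (1 : ℝ) ≤ ‖q i - q j‖) ∧ ∀ i, ∀ p ∈ Y, p.1 ∉ Λ → (1 : ℝ) ≤ ‖q i - p.1‖} with hHq
  have hH_ae : ∀ᵐ x ∂(Measure.pi fun _ : Fin k => ((volume : Measure V3).restrict Λ).prod (gaussMeasure u₀ θ)),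
      x ∈ H ↔ (fun i => (x i).1) ∈ Hq := by
    filter_upwards [ae_pi_prod_restrict_good hΛ hΛ1 (gaussMeasure u₀ θ) k] with x hx
    exact hardCoreIn_superposeIn_iff 1 Λ hx.1 hx.2 Y
  rw [← integral_indicator hHm]
  have h1 : (fun x => H.indicator (fun x : Fin k → V3 × V3 => g ((Real.sqrt θ)⁻¹ • ((x i).2 - u₀))) x)
      =ᵐ[Measure.pi fun _ : Fin k => ((volume : Measure V3).restrict Λ).prod (gaussMeasure u₀ θ)]
      fun x => Hq.indicator (fun _ => (1 : ℝ)) (fun i => (x i).1) * g ((Real.sqrt θ)⁻¹ • ((x i).2 - u₀)) := by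
    filter_upwards [hH_ae] with x hx
    by_cases hxH : x ∈ H
    · rw [Set.indicator_of_mem hxH, Set.indicator_of_mem (hx.1 hxH), one_mul]
    · rw [Set.indicator_of_notMem hxH, Set.indicator_of_notMem (fun h => hxH (hx.2 h)), zero_mul]
  rw [integral_congr_ae h1]
  have h2 := (measurePreserving_arrowProdEquivProdArrow V3 V3 (Fin k) (fun _ => (volume : Measure V3).restrict Λ)
    (fun _ => gaussMeasure u₀ θ)).integral_comp'
    (fun y : (Fin k → V3) × (Fin k → V3) => Hq.indicator (fun _ => (1 : ℝ)) y.1 * g ((Real.sqrt θ)⁻¹ • (y.2 i - u₀)))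
  have h2' : ∫ x, Hq.indicator (fun _ => (1 : ℝ)) (fun i => (x i).1) * g ((Real.sqrt θ)⁻¹ • ((x i).2 - u₀))
      ∂(Measure.pi fun _ : Fin k => ((volume : Measure V3).restrict Λ).prod (gaussMeasure u₀ θ)) =
      ∫ y : (Fin k → V3) × (Fin k → V3), Hq.indicator (fun _ => (1 : ℝ)) y.1 * g ((Real.sqrt θ)⁻¹ • (y.2 i - u₀))
        ∂((Measure.pi fun _ : Fin k => (volume : Measure V3).restrict Λ).prod
          (Measure.pi fun _ : Fin k => gaussMeasure u₀ θ)) := h2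
  rw [h2', integral_prod_mul (μ := Measure.pi fun _ : Fin k => (volume : Measure V3).restrict Λ)
    (ν := Measure.pi fun _ : Fin k => gaussMeasure u₀ θ) (fun q : Fin k → V3 => Hq.indicator (fun _ => (1 : ℝ)) q)
    (fun v : Fin k → V3 => g ((Real.sqrt θ)⁻¹ • (v i - u₀)))]
  have h3 : ∫ v : Fin k → V3, g ((Real.sqrt θ)⁻¹ • (v i - u₀)) ∂(Measure.pi fun _ : Fin k => gaussMeasure u₀ θ) = 0 := by
    have h4 : ∫ v : Fin k → V3, g ((Real.sqrt θ)⁻¹ • (v i - u₀)) ∂(Measure.pi fun _ : Fin k => gaussMeasure u₀ θ) =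
        ∫ w, g ((Real.sqrt θ)⁻¹ • (w - u₀)) ∂((Measure.pi fun _ : Fin k => gaussMeasure u₀ θ).map (Function.eval i)) :=
      (integral_map ((measurable_pi_apply i).aemeasurable (μ := Measure.pi fun _ : Fin k => gaussMeasure u₀ θ))
        (by fun_prop : Continuous fun w : V3 => g ((Real.sqrt θ)⁻¹ • (w - u₀))).aestronglyMeasurable).symm
    rw [h4, (measurePreserving_eval (fun _ : Fin k => gaussMeasure u₀ θ) i).map_eq, integral_comp_rescale_gaussMeasure hθ u₀ g,
      hg0]
  rw [h3, mul_zero]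

/-- **The mean of the thrown one-body sum vanishes** on the hard-core event: `∫_H Σᵢ g((√θ)⁻¹((x i).2 − u₀)) = 0`. -/
theorem setIntegral_hardCore_sum_eq_zero {θ : ℝ} (hθ : 0 < θ) (u₀ : V3) {g : V3 → ℝ} {κ : ℝ} (hg : Continuous g)
    (hgκ : ∀ v, |g v| ≤ κ) (hg0 : ∫ v, g v ∂(stdGaussian V3) = 0) {Λ : Set V3} (hΛ : MeasurableSet Λ)
    (hΛ1 : volume Λ = 1) (Y : PointConfig (V3 × V3)) (k : ℕ) :
    ∫ x in {x : Fin k → V3 × V3 | HardCoreIn 1 Λ (superposeIn Λ x Y)}, ∑ i, g ((Real.sqrt θ)⁻¹ • ((x i).2 - u₀))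
      ∂(Measure.pi fun _ : Fin k => ((volume : Measure V3).restrict Λ).prod (gaussMeasure u₀ θ)) = 0 := by
  haveI : IsProbabilityMeasure ((volume : Measure V3).restrict Λ) := ⟨by rw [Measure.restrict_apply_univ, hΛ1]⟩
  rw [integral_finsetSum Finset.univ (f := fun (i : Fin k) (x : Fin k → V3 × V3) => g ((Real.sqrt θ)⁻¹ • ((x i).2 - u₀)))
    fun i _ => (integrable_of_continuous_abs_le
      (by fun_prop : Continuous fun x : Fin k → V3 × V3 => g ((Real.sqrt θ)⁻¹ • ((x i).2 - u₀))) fun x => hgκ _)]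
  exact Finset.sum_eq_zero fun i _ => setIntegral_hardCore_velocity_eq_zero hθ u₀ hg hg0 hΛ hΛ1 Y k i

/-- **Per-`k` identity for the specification**: on the hard-core event, the positive-part Campbell sums of the cut-off
observable `u` and of `−u` have the same `(Leb|_Λ ⊗ 𝒩(u₀,θI))^{⊗k}`-integral after superposition. -/
theorem setLIntegral_posSum_superposeIn_eq {θ : ℝ} (hθ : 0 < θ) (u₀ : V3) {g : V3 → ℝ} {κ : ℝ} (hg : Continuous g)
    (hgκ : ∀ v, |g v| ≤ κ) (hg0 : ∫ v, g v ∂(stdGaussian V3) = 0) {Λ : Set V3} (hΛ : MeasurableSet Λ)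
    (hΛ1 : volume Λ = 1) (Y : PointConfig (V3 × V3)) (k : ℕ) :
    ∫⁻ x in {x : Fin k → V3 × V3 | HardCoreIn 1 Λ (superposeIn Λ x Y)},
        posSum ((Prod.fst ⁻¹' Λ).indicator fun p => g ((Real.sqrt θ)⁻¹ • (p.2 - u₀))) (superposeIn Λ x Y)
        ∂(Measure.pi fun _ : Fin k => ((volume : Measure V3).restrict Λ).prod (gaussMeasure u₀ θ)) =
      ∫⁻ x in {x : Fin k → V3 × V3 | HardCoreIn 1 Λ (superposeIn Λ x Y)},
        posSum (fun p => -(Prod.fst ⁻¹' Λ).indicator (fun p => g ((Real.sqrt θ)⁻¹ • (p.2 - u₀))) p) (superposeIn Λ x Y)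
        ∂(Measure.pi fun _ : Fin k => ((volume : Measure V3).restrict Λ).prod (gaussMeasure u₀ θ)) := by
  haveI : IsProbabilityMeasure ((volume : Measure V3).restrict Λ) := ⟨by rw [Measure.restrict_apply_univ, hΛ1]⟩
  set Gt : V3 × V3 → ℝ := fun p => g ((Real.sqrt θ)⁻¹ • (p.2 - u₀)) with hGt
  set u : V3 × V3 → ℝ := (Prod.fst ⁻¹' Λ).indicator Gt with hu
  set ρk : Measure (Fin k → V3 × V3) := Measure.pi fun _ : Fin k => ((volume : Measure V3).restrict Λ).prod (gaussMeasure u₀ θ)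
    with hρk
  set H : Set (Fin k → V3 × V3) := {x | HardCoreIn 1 Λ (superposeIn Λ x Y)} with hH
  have hu0 : ∀ p : V3 × V3, p.1 ∉ Λ → u p = 0 := fun p hp => Set.indicator_of_notMem (show p ∉ Prod.fst ⁻¹' Λ from hp) _
  have hu0' : ∀ p : V3 × V3, p.1 ∉ Λ → (fun p => -u p) p = 0 := fun p hp => by simp only [hu0 p hp, neg_zero]
  have huin : ∀ p : V3 × V3, p.1 ∈ Λ → u p = Gt p := fun p hp => Set.indicator_of_mem (show p ∈ Prod.fst ⁻¹' Λ from hp) _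
  have hgood := ae_pi_prod_restrict_good hΛ hΛ1 (gaussMeasure u₀ θ) k
  have hinj : ∀ x : Fin k → V3 × V3, (∀ i j, (x i).1 = (x j).1 → i = j) → Function.Injective x :=
    fun x h i j hij => h i j (by rw [hij])
  -- the two Campbell sums on good superpositions
  have hP : ∀ᵐ x ∂ρk, posSum u (superposeIn Λ x Y) = ENNReal.ofReal (∑ i, max (Gt (x i)) 0) := by
    filter_upwards [hgood] with x hx
    rw [posSum_superposeIn hu0 hx.1 (hinj x hx.2) Y]
    congr 1
    exact Finset.sum_congr rfl fun i _ => by rw [huin _ (hx.1 i)]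
  have hN : ∀ᵐ x ∂ρk, posSum (fun p => -u p) (superposeIn Λ x Y) = ENNReal.ofReal (∑ i, max (-Gt (x i)) 0) := by
    filter_upwards [hgood] with x hx
    rw [posSum_superposeIn hu0' hx.1 (hinj x hx.2) Y]
    congr 1
    exact Finset.sum_congr rfl fun i _ => by simp only [huin _ (hx.1 i)]
  -- integrability of the finite sums
  have hcont : ∀ i : Fin k, Continuous fun x : Fin k → V3 × V3 => Gt (x i) := fun i =>
    (by fun_prop : Continuous fun x : Fin k → V3 × V3 => g ((Real.sqrt θ)⁻¹ • ((x i).2 - u₀)))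
  have hSp_int : Integrable (fun x : Fin k → V3 × V3 => ∑ i, max (Gt (x i)) 0) (ρk.restrict H) :=
    integrable_finsetSum _ fun i _ => integrable_of_continuous_abs_le ((hcont i).max continuous_const) fun x => by
      rw [abs_of_nonneg (le_max_right _ _)]; exact max_le ((le_abs_self _).trans (hgκ _)) ((abs_nonneg _).trans (hgκ 0))
  have hSn_int : Integrable (fun x : Fin k → V3 × V3 => ∑ i, max (-Gt (x i)) 0) (ρk.restrict H) :=
    integrable_finsetSum _ fun i _ => integrable_of_continuous_abs_le ((hcont i).neg.max continuous_const) fun x => by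
      rw [abs_of_nonneg (le_max_right _ _)]; exact max_le ((neg_le_abs _).trans (hgκ _)) ((abs_nonneg _).trans (hgκ 0))
  -- the real identity
  have hreal : ∫ x in H, (∑ i, max (Gt (x i)) 0) ∂ρk = ∫ x in H, (∑ i, max (-Gt (x i)) 0) ∂ρk := by
    refine sub_eq_zero.1 ?_
    rw [← integral_sub hSp_int hSn_int]
    have : (fun x : Fin k → V3 × V3 => (∑ i, max (Gt (x i)) 0) - ∑ i, max (-Gt (x i)) 0) =
        fun x => ∑ i, Gt (x i) := by
      funext x
      rw [← Finset.sum_sub_distrib]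
      exact Finset.sum_congr rfl fun i _ => max_zero_sub_max_neg_zero_eq_self _
    rw [this]
    exact setIntegral_hardCore_sum_eq_zero hθ u₀ hg hgκ hg0 hΛ hΛ1 Y k
  calc ∫⁻ x in H, posSum u (superposeIn Λ x Y) ∂ρk = ∫⁻ x in H, ENNReal.ofReal (∑ i, max (Gt (x i)) 0) ∂ρk :=
        lintegral_congr_ae (ae_restrict_of_ae hP)
    _ = ENNReal.ofReal (∫ x in H, (∑ i, max (Gt (x i)) 0) ∂ρk) :=
        (ofReal_integral_eq_lintegral_ofReal hSp_int (ae_of_all _ fun x =>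
          Finset.sum_nonneg fun i _ => le_max_right _ _)).symm
    _ = ENNReal.ofReal (∫ x in H, (∑ i, max (-Gt (x i)) 0) ∂ρk) := by rw [hreal]
    _ = ∫⁻ x in H, ENNReal.ofReal (∑ i, max (-Gt (x i)) 0) ∂ρk :=
        ofReal_integral_eq_lintegral_ofReal hSn_int (ae_of_all _ fun x => Finset.sum_nonneg fun i _ => le_max_right _ _)
    _ = ∫⁻ x in H, posSum (fun p => -u p) (superposeIn Λ x Y) ∂ρk :=
        lintegral_congr_ae ((ae_restrict_of_ae hN).mono fun x hx => hx.symm)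

/-! ## The sanity instance of the wall -/

/-- **Registered stub `stub_gibbsFastBiasVanishes`** (SANITY instance of the wall of line `FirstLemma`): under a
hard-sphere DLR Gibbs state at inverse temperature `θ⁻¹` and drift `u₀` (any activity `z > 0`), the unit-cube window
functional of a bounded continuous standard-Gaussian-centred fast observable `g((√θ)⁻¹(v − u₀))` is integrable and has
mean zero. -/
theorem stub_gibbsFastBiasVanishes : ∀ (z θ : ℝ) (u₀ : V3) (G : Measure (PointConfig (V3 × V3))), 0 < z → 0 < θ →
    IsHardSphereGibbs 1 z θ⁻¹ u₀ G →
    ∀ (g : V3 → ℝ) (κ : ℝ), Continuous g → (∀ v, |g v| ≤ κ) →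
      ∫ v, g v ∂(stdGaussian V3) = 0 →
      Integrable (fun ω : PointConfig (V3 × V3) =>
          windowSumReal ω (Literature.Analysis.FunctionSpaces.Torus.unitCube (Fin 3)) (fun p => g ((Real.sqrt θ)⁻¹ • (p.2 - u₀)))) G ∧
        ∫ ω, windowSumReal ω (Literature.Analysis.FunctionSpaces.Torus.unitCube (Fin 3))
            (fun p => g ((Real.sqrt θ)⁻¹ • (p.2 - u₀))) ∂G = 0 := by
  intro z θ u₀ G hz hθ hG g κ hg hgκ hg0
  classical
  haveI : IsProbabilityMeasure G := hG.1
  set C₀ : Set V3 := unitCube (Fin 3) with hC₀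
  set Gt : V3 × V3 → ℝ := fun p => g ((Real.sqrt θ)⁻¹ • (p.2 - u₀)) with hGt
  have hC₀m : MeasurableSet C₀ := measurableSet_unitCube
  obtain ⟨hC₀b, hC₀1⟩ : Bornology.IsBounded C₀ ∧ volume C₀ = 1 := ⟨Literature.MathematicalPhysics.StatisticalMechanics.isBounded_unitCube,
    Literature.MathematicalPhysics.StatisticalMechanics.volume_unitCube⟩
  have hGtc : Continuous Gt := (by fun_prop : Continuous fun p : V3 × V3 => g ((Real.sqrt θ)⁻¹ • (p.2 - u₀)))
  have hGtκ : ∀ p, |Gt p| ≤ κ := fun p => hgκ _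
  have hκ0 : 0 ≤ κ := (abs_nonneg _).trans (hgκ 0)
  have hρ : maxwellPhaseMeasure θ⁻¹ u₀ C₀ = ((volume : Measure V3).restrict C₀).prod (gaussMeasure u₀ θ) :=
    maxwellPhaseMeasure_inv_eq_prod_gaussMeasure hθ u₀ C₀
  haveI : IsProbabilityMeasure ((volume : Measure V3).restrict C₀) := ⟨by rw [Measure.restrict_apply_univ, hC₀1]⟩
  have hρ1 : maxwellPhaseMeasure θ⁻¹ u₀ C₀ univ = 1 := by rw [hρ]; exact measure_univ
  -- finite intensity above the cube
  set Cyl : Set (V3 × V3) := C₀ ×ˢ (univ : Set V3) with hCyl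
  have hcountm : Measurable fun ω : PointConfig (V3 × V3) => ((ω.count Cyl : ℕ∞) : ℝ≥0∞) :=
    measurable_toENNReal_count (hC₀m.prod MeasurableSet.univ)
  have hfin : ∫⁻ ω, ((ω.count Cyl : ℕ∞) : ℝ≥0∞) ∂G ≠ ⊤ := by
    refine ne_top_of_le_ne_top ?_ (lintegral_count_le_of_isHardSphereGibbs hG hC₀m hC₀b)
    rw [hρ1]
    exact (tsum_ofReal_pow_div_factorial_mul_lt_top hz.le ENNReal.one_ne_top).ne
  -- integrability (bookkeeping of `windowSum_approx` with the trivial cut-offs)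
  have hint : Integrable (fun ω => windowSumReal ω C₀ Gt) G :=
    (windowSum_approx G hfin hGtc hGtκ (ψ := fun _ => 0) continuous_const (fun _ => le_rfl) (fun _ => zero_le_one)
      (fun y hy => absurd rfl hy) hC₀m subset_rfl (fun y hy hyS => absurd hy hyS) (χ := fun _ => 1) continuous_const
      (fun _ => zero_le_one) (fun _ => le_rfl) (R := 0) (fun _ _ => rfl)).1
  refine ⟨hint, ?_⟩
  -- measurable representatives
  set u : V3 × V3 → ℝ := (Prod.fst ⁻¹' C₀).indicator Gt with hu
  have hum : Measurable u := hGtc.measurable.indicator (hC₀m.preimage measurable_fst)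
  have hu0 : ∀ p : V3 × V3, p.1 ∉ C₀ → u p = 0 := fun p hp => Set.indicator_of_notMem (show p ∉ Prod.fst ⁻¹' C₀ from hp) _
  have huκ : ∀ p, |u p| ≤ κ := fun p => by
    rw [hu, Set.indicator_apply]
    split_ifs
    · exact hGtκ p
    · rw [abs_zero]; exact hκ0
  have hPm : Measurable (posSum u) := measurable_posSum hum
  have hNm : Measurable (posSum fun p => -u p) := measurable_posSum hum.neg
  have hP_le : ∀ ω, posSum u ω ≤ ENNReal.ofReal κ * ((ω.count Cyl : ℕ∞) : ℝ≥0∞) := posSum_le_count hκ0 huκ hu0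
  have hN_le : ∀ ω, posSum (fun p => -u p) ω ≤ ENNReal.ofReal κ * ((ω.count Cyl : ℕ∞) : ℝ≥0∞) :=
    posSum_le_count hκ0 (fun p => by rw [abs_neg]; exact huκ p) (fun p hp => by simp only [hu0 p hp, neg_zero])
  have hbd : ∫⁻ ω, ENNReal.ofReal κ * ((ω.count Cyl : ℕ∞) : ℝ≥0∞) ∂G ≠ ⊤ := by
    rw [lintegral_const_mul _ hcountm]; exact ENNReal.mul_ne_top ENNReal.ofReal_ne_top hfin
  have hP_fin : ∫⁻ ω, posSum u ω ∂G ≠ ⊤ := ne_top_of_le_ne_top hbd (lintegral_mono hP_le)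
  have hN_fin : ∫⁻ ω, posSum (fun p => -u p) ω ∂G ≠ ⊤ := ne_top_of_le_ne_top hbd (lintegral_mono hN_le)
  -- the window functional agrees a.s. with the difference of the representatives
  have hae : ∀ᵐ ω ∂G, ((ω.count Cyl : ℕ∞) : ℝ≥0∞) < ⊤ := ae_lt_top hcountm hfin
  have hgood : ∀ ω : PointConfig (V3 × V3), ((ω.count Cyl : ℕ∞) : ℝ≥0∞) < ⊤ → (particlesIn ω C₀).Finite := by
    intro ω hω
    simp only [ENat.toENNReal_lt_top] at hω
    have h : (ω.carrier ∩ Cyl).encard < ⊤ := hω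
    rw [Set.encard_lt_top_iff] at h
    rw [Literature.Analysis.FluidPDE.particlesIn_eq, hCyl, Set.prod_univ] at *
    exact h
  have hWeq : (fun ω => windowSumReal ω C₀ Gt) =ᵐ[G] fun ω => (posSum u ω).toReal - (posSum (fun p => -u p) ω).toReal :=
    hae.mono fun ω hω => windowSumReal_eq_posSum_sub (hgood ω hω) Gt
  rw [integral_congr_ae hWeq, integral_sub (integrable_toReal_of_lintegral_ne_top hPm.aemeasurable hP_fin)
    (integrable_toReal_of_lintegral_ne_top hNm.aemeasurable hN_fin), integral_toReal hPm.aemeasurable (ae_lt_top hPm hP_fin),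
    integral_toReal hNm.aemeasurable (ae_lt_top hNm hN_fin), sub_eq_zero]
  congr 1
  -- DLR for functions: both sides disintegrate along the specification, fibrewise equal
  rw [lintegral_eq_lintegral_gibbsSpecMeasure hG hC₀m hC₀b hPm.aemeasurable,
    lintegral_eq_lintegral_gibbsSpecMeasure hG hC₀m hC₀b hNm.aemeasurable]
  refine lintegral_congr fun Y => ?_
  rw [lintegral_gibbsSpecMeasure, lintegral_gibbsSpecMeasure, lintegral_gibbsWeightMeasure 1 z θ⁻¹ u₀ hC₀m Y hPm,
    lintegral_gibbsWeightMeasure 1 z θ⁻¹ u₀ hC₀m Y hNm]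
  congr 1
  refine tsum_congr fun k => ?_
  congr 1
  rw [hρ]
  exact setLIntegral_posSum_superposeIn_eq hθ u₀ hg hgκ hg0 hC₀m hC₀1 Y k

/-- **The wall holds at a Gibbs state** (consistency check of `EntropicBoltzmannPropertyTangent` at `μ = G′`, a Gibbs state
at the same `(θ⁻¹, u₀)` and any activity): the left-hand side of the wall's inequality vanishes, so it holds against every
reference law `G`. -/
theorem wall_inequality_of_isHardSphereGibbs {z' θ : ℝ} {u₀ : V3} {G' : Measure (PointConfig (V3 × V3))} (hz' : 0 < z')
    (hθ : 0 < θ) (hG' : IsHardSphereGibbs 1 z' θ⁻¹ u₀ G') {g : V3 → ℝ} {κ : ℝ} (hg : Continuous g) (hgκ : ∀ v, |g v| ≤ κ)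
    (hg0 : ∫ v, g v ∂(stdGaussian V3) = 0) (G : Measure (PointConfig (V3 × V3))) :
    ENNReal.ofReal |∫ ω, windowSumReal ω (unitCube (Fin 3)) (fun p => g ((Real.sqrt θ)⁻¹ • (p.2 - u₀))) ∂G'| ≤
      specificRelEntropy G' G := by
  rw [(stub_gibbsFastBiasVanishes z' θ u₀ G' hz' hθ hG' g κ hg hgκ hg0).2, abs_zero, ENNReal.ofReal_zero]
  exact zero_le

end Summit.AtomisticToContinuum.HydrodynamicLimit.Theorems.KiferCompactification
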